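import Summits.BirchSwinnertonDyer.Rank1Residual.X12.CMRamifiedRecordSchemaI
import Summits.BirchSwinnertonDyer.Rank1Residual.X12.CubicModelKodaira
import Summits.BirchSwinnertonDyer.Rank1Residual.AdditivePotMult.QuadraticBaseChangeTamagawaTypeIVInert
import Summits.BirchSwinnertonDyer.Rank1Residual.AdditivePotMult.QuadraticBaseChangeOddTamagawaAdditiveAll
import Literature.NumberTheory.EllipticCurves.MordellCurveTateAlgorithmTwoProofs
import Literature.NumberTheory.DiophantineGeometry.KodairaSymbolUnramifiedBaseChangeProofs
import Literature.NumberTheory.EllipticCurves.NeronComponentIndexProofs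
import Literature.NumberTheory.EllipticCurves.NeronComponentIndexTypeI0starProofs
import Literature.NumberTheory.EllipticCurves.TamagawaSubgroupProofs
import Literature.NumberTheory.EllipticCurves.HeegnerPointsKolyvaginGoodReductionProofs
import HarnessLib

/-!
# PART I MEANING, local half — the Kodaira type of `y² = x³ + k` at every prime `ℓ ≠ 3` from
# `v_ℓ(k)`, and `ord₃ c_w(W_K)` at an unramified place `w ∣ ℓ` of residue degree `2`
# (cell `bsd-print-cfram`, typer seat `ty3`; companion of `X12/CMRamifiedRecordSchemaI.lean`)

HONEST FRAMING (cell `bsd-print-cfram`, run/shared/lean/pub/bsd-print-cfram/, verbatim in every file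
of the cell): PARTITION currency only — the leaf counts when its class theorem is in the kernel BY
NAME, flag-free; Literature named facts are statement-only with cite tags, never sorried theorems;
every imported theorem carries its printed hypotheses verbatim; numbers, not adjectives. THIS FILE:
THEOREMS ONLY (no definition, no named fact, no `sorry`); TOOL theorems about Tate's algorithm; nothing
about BSD is asserted or booked; no mark moves.

## What is here (for `W/ℚ` elliptic, `C • W = (y² = x³ + k)`, `k ≠ 0`, `v` a place of `ℚ`, `ℓ = natGenerator v`)

* §1 (`ℓ ≥ 5`) `hasGoodReductionAt_or_kodairaSymbolAt_of_mordell`: with `a = v_ℓ(k)`, good at `v` if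
  `6 ∣ a`, else Kodaira type II, IV, I₀*, IV*, II* as `a mod 6 = 1, …, 5` — the tree's cubic Tate engine
  `kodairaSymbolAt_of_cubic_model` (`X12/CubicModelKodaira.lean`) after rescaling by `ℓ^{6⌊a/6⌋}`.
* §2 (`ℓ = 2`, `64 ∤ k`) `kodairaSymbolAt_two_of_mordell`: type IV / IV* iff `twoAdicIVBit k (v₂ k) = 1`
  (`v₂(k) ∈ {0, 2}`, `k/2^{v₂ k} ≡ 1 (4)`), else good or II / I₀* / II* — the nine rows of the tree's
  table `MordellCurveTateAlgorithmTwoProofs`.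
* §3 (`K` any number field, `w ∣ v`, `e(w|v) = 1`): `ord₃ c_w(W_K) = 1` at IV / IV* when `f(w|v)` is
  even (tree `TypeIVTwist.…_eq_three_…`: `c_w = 3`); `= 0` at II / I₀* / II* (Kodaira transport A233 +
  `c_w ∈ {1}, {1,2,4}, {1}`) and above good places (`c_w = 1`).
* §4 `padicValNat_localTamagawaNumber_baseChange_of_mordell`: at `w` with `e = 1`, `f = 2` over
  `ℓ ≠ 3` (`64 ∤ k`): `ord₃ c_w(W_K) = twoAdicIVBit k (v₂ k)` if `ℓ = 2`, else `[v_ℓ(k) mod 6 ∈ {2, 4}]`.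

References: [SilvermanATAEC1994] IV.9.4 and Table 4.1; [SilvermanAEC2009] VII.1 Rem. 1.1,
Prop. VII.5.4 (a); HOME/ty3/CERT-TABLE-K12r.md §PART I.
-/

noncomputable section

open scoped Classical NumberField
open WeierstrassCurve NumberField IsDedekindDomain IsDedekindDomain.HeightOneSpectrum
  Rat.HeightOneSpectrum Literature.NumberTheory.EllipticCurves
  Literature.NumberTheory.GaloisRepresentations
  Literature.NumberTheory.DiophantineGeometry
  Literature.NumberTheory.DiophantineGeometry.TateAlgorithm

namespace Summit.BirchSwinnertonDyer.Rank1Residual.X12.CMRamifiedRecords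

/-! ### §0 Valuations of an integer at a place of `ℚ` -/

/-- `|k|_v = ℓ^{-v_ℓ(k)}` read off the factorisation of `|k|` (`|k| = ℓ^a · c`, `ℓ ∤ c`). [folklore] -/
theorem valuation_intCast_eq_exp_neg_factorization (v : HeightOneSpectrum (𝓞 ℚ)) {k : ℤ}
    (hk : k ≠ 0) :
    v.valuation ℚ (k : ℚ) =
      WithZero.exp (-((k.natAbs.factorization (natGenerator v) : ℕ) : ℤ)) := by
  set ℓ := natGenerator v with hℓdef
  have hℓ : ℓ.Prime := prime_natGenerator v
  set a := k.natAbs.factorization ℓ with hadef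
  set c := k.natAbs / ℓ ^ a with hcdef
  have hdec : ℓ ^ a * c = k.natAbs := Nat.ordProj_mul_ordCompl_eq_self k.natAbs ℓ
  have hndvd : ¬ ℓ ∣ c := Nat.not_dvd_ordCompl hℓ (Int.natAbs_ne_zero.2 hk)
  have hc : v.valuation ℚ ((c : ℤ) : ℚ) = 1 :=
    Rat.valuation_intCast_eq_one v (n := (c : ℤ)) (by exact_mod_cast hndvd)
  have hℓa : v.valuation ℚ ((ℓ : ℚ) ^ a) = WithZero.exp (-(a : ℤ)) := by
    rw [map_pow, Rat.valuation_natGenerator v, ← WithZero.exp_nsmul]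
    congr 1; simp
  have habs : v.valuation ℚ ((k.natAbs : ℤ) : ℚ) = WithZero.exp (-(a : ℤ)) := by
    rw [show ((k.natAbs : ℤ) : ℚ) = (ℓ : ℚ) ^ a * ((c : ℤ) : ℚ) by
      rw [← hdec]; push_cast; ring, map_mul, hℓa, hc, mul_one]
  push_cast at habs
  rcases Int.natAbs_eq k with h | h
  · conv_lhs => rw [h]
    push_cast
    exact habs
  · conv_lhs => rw [h]
    push_cast
    rw [Valuation.map_neg]
    exact habs

/-! ### §1 The Kodaira type of `y² = x³ + k` at a prime `ℓ ≥ 5` -/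

section OddPrime

variable (W : WeierstrassCurve ℚ) [W.IsElliptic] {C : VariableChange ℚ} {k : ℤ}
  (v : HeightOneSpectrum (𝓞 ℚ))

/-- **`y² = x³ + k` at `ℓ ≥ 5`: good reduction when `6 ∣ v_ℓ(k)`, else Kodaira type II, IV, I₀*, IV*,
II* as `v_ℓ(k) mod 6 = 1, …, 5`** — rescale by `ℓ^{6⌊a/6⌋}` (`smul_cubic_scale`) to
`y² = x³ + b`, `ord_v b = a mod 6`, then the `s = 0` good-reduction criterion (`ord Δ = 0`, minimal)
or the cubic Tate engine `kodairaSymbolAt_of_cubic_model`.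
[cite: SilvermanATAEC1994, IV.9.4 Steps 1–10 and Table 4.1] [cite: SilvermanAEC2009, VII.1 Remark 1.1] -/
theorem hasGoodReductionAt_or_kodairaSymbolAt_of_mordell (hM : C • W = ⟨0, 0, 0, 0, (k : ℚ)⟩)
    (hk : k ≠ 0) (hv2 : natGenerator v ≠ 2) (hv3 : natGenerator v ≠ 3) :
    let a := k.natAbs.factorization (natGenerator v)
    (a % 6 = 0 → W.HasGoodReductionAt v) ∧
    (a % 6 ≠ 0 → W.kodairaSymbolAt v =
      if a % 6 = 1 then .II else if a % 6 = 2 then .IV else if a % 6 = 3 then .Istar 0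
      else if a % 6 = 4 then .IVstar else .IIstar) := by
  intro a
  have hℓ0 : (natGenerator v : ℚ) ≠ 0 := by exact_mod_cast (prime_natGenerator v).ne_zero
  have hp2 : ¬ (natGenerator v : ℤ) ∣ 2 := fun h ↦ hv2 <|
    (Nat.prime_dvd_prime_iff_eq (prime_natGenerator v) Nat.prime_two).mp (by exact_mod_cast h)
  have hp3 : ¬ (natGenerator v : ℤ) ∣ 3 := fun h ↦ hv3 <|
    (Nat.prime_dvd_prime_iff_eq (prime_natGenerator v) Nat.prime_three).mp (by exact_mod_cast h)
  have h2 : v.valuation ℚ (2 : ℚ) = 1 := by exact_mod_cast Rat.valuation_intCast_eq_one v hp2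
  have h3 : v.valuation ℚ (3 : ℚ) = 1 := by exact_mod_cast Rat.valuation_intCast_eq_one v hp3
  have h432 : v.valuation ℚ (432 : ℚ) = 1 := by
    rw [show (432 : ℚ) = 2 ^ 4 * 3 ^ 3 by norm_num, map_mul, map_pow, map_pow, h2, h3, one_pow,
      one_pow, one_mul]
  have hℓ : v.valuation ℚ (natGenerator v : ℚ) = WithZero.exp (-1 : ℤ) := Rat.valuation_natGenerator v
  have hvk : v.valuation ℚ (k : ℚ) = WithZero.exp (-(a : ℤ)) :=
    valuation_intCast_eq_exp_neg_factorization v hk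
  obtain ⟨m, s, hs6, has⟩ : ∃ (m : ℕ) (s : ℕ), s < 6 ∧ a = 6 * m + s := ⟨a / 6, a % 6, Nat.mod_lt _ (by norm_num), (Nat.div_add_mod a 6).symm⟩
  have hsmod : a % 6 = s := by rw [has]; omega
  set u : ℚˣ := Units.mk0 ((natGenerator v : ℚ) ^ m) (pow_ne_zero m hℓ0) with hu
  set b : ℚ := ((u⁻¹ : ℚˣ) : ℚ) ^ 6 * (k : ℚ) with hb_def
  have hscale : (⟨u, 0, 0, 0⟩ : VariableChange ℚ) • (⟨0, 0, 0, 0, (k : ℚ)⟩ : WeierstrassCurve ℚ) =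
      ⟨0, 0, 0, 0, b⟩ := by
    rw [smul_cubic_scale]
  have hvu : v.valuation ℚ (((u⁻¹ : ℚˣ) : ℚ) ^ 6) = WithZero.exp ((6 * m : ℕ) : ℤ) := by
    rw [Units.val_inv_eq_inv_val, hu, Units.val_mk0, map_pow, map_inv₀, map_pow, hℓ,
      ← WithZero.exp_nsmul, ← WithZero.exp_neg, ← WithZero.exp_nsmul]
    congr 1; simp
  have hvb : v.valuation ℚ b = WithZero.exp (-(s : ℤ)) := by
    rw [hb_def, map_mul, hvu, hvk, ← WithZero.exp_add]
    congr 1; push_cast; omega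
  have hMW : (⟨0, 0, 0, 0, b⟩ : WeierstrassCurve ℚ) = ((⟨u, 0, 0, 0⟩ : VariableChange ℚ) * C) • W := by
    rw [mul_smul, hM, hscale]
  refine ⟨fun h0 => ?_, fun h0 => ?_⟩
  · have hs0 : s = 0 := by omega
    subst hs0
    set M : WeierstrassCurve ℚ := ⟨0, 0, 0, 0, b⟩ with hMdef
    haveI : M.IsElliptic := by rw [hMW]; infer_instance
    have hvb1 : v.valuation ℚ b = 1 := by rw [hvb]; simp
    have hint : M.IsIntegralAt v :=
      M.isIntegralAt_of_valuation_le_one v (by simp [hMdef]) (by simp [hMdef]) (by simp [hMdef])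
        (by simp [hMdef]) (by rw [show M.a₆ = b from rfl, hvb1])
    have hΔ1 : v.valuation ℚ M.Δ = 1 := by
      rw [show M.Δ = -(432 : ℚ) * b ^ 2 by
        simp only [hMdef, WeierstrassCurve.Δ, WeierstrassCurve.b₂, WeierstrassCurve.b₄,
          WeierstrassCurve.b₆, WeierstrassCurve.b₈]; ring,
        map_mul, Valuation.map_neg, h432, one_mul, map_pow, hvb1, one_pow]
    have hmin : M.IsMinimalAt v := isMinimalAt_of_lt_valuation_Δ_holds hint
      (by rw [hΔ1, ← WithZero.exp_zero]; exact WithZero.exp_lt_exp.mpr (by norm_num))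
    have hgoodM := (hasGoodReductionAt_iff_of_isMinimalAt (v := v) (W := M) hmin).mpr hΔ1
    rw [hMW] at hgoodM
    exact (hasGoodReductionAt_smul_iff_holds v W _).mp hgoodM
  · have hs1 : 1 ≤ s := by omega
    have hT := kodairaSymbolAt_of_cubic_model W v hv2 hv3 _ ((⟨u, 0, 0, 0⟩ : VariableChange ℚ) * C)
      hMW rfl hs1 (by omega) hvb
    rw [hT, hsmod]

end OddPrime

/-! ### §2 The Kodaira type of `y² = x³ + k` at `2` (`64 ∤ k`) -/

section Two

variable (W : WeierstrassCurve ℚ) [W.IsElliptic] {C : VariableChange ℚ} {k : ℤ}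
  (v : HeightOneSpectrum (𝓞 ℚ))

/-- **`y² = x³ + k` at `2`, `64 ∤ k`: type IV / IV* iff `twoAdicIVBit k (v₂ k) = 1`, otherwise good
or of type II / I₀* / II*.** With `a = v₂(k) ≤ 5`, `u = k/2ᵃ` odd: the nine rows of the tree's table
(`kodairaSymbolAt_and_ordMinimalDiscriminant_mordell_*`, `hasGoodReductionAt_mordell_four_of_emod_four_eq_one`
of `MordellCurveTateAlgorithmTwoProofs`), transported from the Mordell model `C • W` to `W`
(`kodairaSymbolAt_smul'`, `hasGoodReductionAt_smul_iff_holds`).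
[cite: SilvermanATAEC1994, IV.9.4 (PDF pp. 344–346) and Table 4.1] -/
theorem kodairaSymbolAt_two_of_mordell (hM : C • W = ⟨0, 0, 0, 0, (k : ℚ)⟩) (hk : k ≠ 0)
    (h64 : ¬ (64 : ℤ) ∣ k) (hv : natGenerator v = 2) :
    let a := k.natAbs.factorization 2
    (twoAdicIVBit k a = 1 → W.kodairaSymbolAt v = .IV ∨ W.kodairaSymbolAt v = .IVstar) ∧
    (twoAdicIVBit k a ≠ 1 → W.HasGoodReductionAt v ∨ W.kodairaSymbolAt v = .II ∨
      W.kodairaSymbolAt v = .Istar 0 ∨ W.kodairaSymbolAt v = .IIstar) := by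
  intro a
  haveI : PerfectField (IsLocalRing.ResidueField (v.adicCompletionIntegers ℚ)) := PerfectField.ofFinite
  set M : WeierstrassCurve ℚ := ⟨0, 0, 0, 0, (k : ℚ)⟩ with hMdef
  haveI : M.IsElliptic := by rw [← hM]; infer_instance
  set c := k.natAbs / 2 ^ a with hcdef
  have hdec : 2 ^ a * c = k.natAbs := Nat.ordProj_mul_ordCompl_eq_self k.natAbs 2
  have hcodd : ¬ 2 ∣ c := Nat.not_dvd_ordCompl Nat.prime_two (Int.natAbs_ne_zero.2 hk)
  set u : ℤ := Int.sign k * c with hudef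
  have hku : k = 2 ^ a * u := by
    have h1 : (k.natAbs : ℤ) = 2 ^ a * (c : ℤ) := by rw [← hdec]; push_cast; ring
    calc k = Int.sign k * (k.natAbs : ℤ) := (Int.sign_mul_natAbs k).symm
      _ = 2 ^ a * u := by rw [h1, hudef]; ring
  have hu2 : ¬ (2 : ℤ) ∣ u := by
    rw [hudef]
    intro h
    rcases lt_or_gt_of_ne hk with hneg | hpos
    · rw [Int.sign_eq_neg_one_of_neg hneg, neg_one_mul, dvd_neg] at h; exact hcodd (by exact_mod_cast h)
    · rw [Int.sign_eq_one_of_pos hpos, one_mul] at h; exact hcodd (by exact_mod_cast h)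
  have ha5 : a ≤ 5 := by
    by_contra h
    apply h64
    rw [hku]
    exact dvd_mul_of_dvd_left (by
      rw [show (64 : ℤ) = 2 ^ 6 by norm_num]; exact pow_dvd_pow 2 (by omega)) u
  have hdiv : k / (2 : ℤ) ^ a = u := by
    rw [hku]; exact Int.mul_ediv_cancel_left _ (pow_ne_zero _ two_ne_zero)
  have e₁ : M.a₁ = 0 := rfl; have e₂ : M.a₂ = 0 := rfl; have e₃ : M.a₃ = 0 := rfl
  have e₄ : M.a₄ = 0 := rfl
  have e₆ : M.a₆ = ((2 ^ a * u : ℤ) : ℚ) := by rw [show M.a₆ = (k : ℚ) from rfl, hku]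
  have hKW : W.kodairaSymbolAt v = M.kodairaSymbolAt v := by
    rw [← hM, kodairaSymbolAt_smul']
  have hGW : M.HasGoodReductionAt v → W.HasGoodReductionAt v := fun h => by
    rw [← hM] at h; exact (hasGoodReductionAt_smul_iff_holds v W C).mp h
  have hu4 : u % 4 = 1 ∨ u % 4 = 3 := by omega
  have hbit : twoAdicIVBit k a = 1 ↔ (a = 0 ∨ a = 2) ∧ u % 4 = 1 := by
    rw [twoAdicIVBit, hdiv]
    by_cases h : (a = 0 ∨ a = 2) ∧ u % 4 = 1
    · simp [h]
    · simp [h]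
  rcases (show a = 0 ∨ a = 1 ∨ a = 2 ∨ a = 3 ∨ a = 4 ∨ a = 5 by omega) with
    h0 | h1 | h2 | h3 | h4 | h5
  · rw [h0, pow_zero, one_mul] at e₆
    rcases hu4 with h41 | h43
    · refine ⟨fun _ => Or.inl ?_, fun hb => absurd (hbit.2 ⟨Or.inl h0, h41⟩) hb⟩
      rw [hKW]
      exact (kodairaSymbolAt_and_ordMinimalDiscriminant_mordell_zero_of_emod_four_eq_one v hv M e₁ e₂
        e₃ e₄ h41 (by rw [e₆])).1
    · refine ⟨fun hb => absurd (hbit.1 hb).2 (by omega), fun _ => Or.inr (Or.inl ?_)⟩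
      rw [hKW]
      exact (kodairaSymbolAt_and_ordMinimalDiscriminant_mordell_zero_of_emod_four_eq_three v hv M e₁
        e₂ e₃ e₄ h43 (by rw [e₆])).1
  · rw [h1, pow_one] at e₆
    refine ⟨fun hb => absurd (hbit.1 hb).1 (by omega), fun _ => Or.inr (Or.inl ?_)⟩
    rw [hKW]
    exact (kodairaSymbolAt_and_ordMinimalDiscriminant_mordell_one v hv M e₁ e₂ e₃ e₄ hu2 e₆).1
  · rw [h2, show ((2 : ℤ) ^ 2) = 4 by norm_num] at e₆
    rcases hu4 with h41 | h43
    · refine ⟨fun _ => Or.inr ?_, fun hb => absurd (hbit.2 ⟨Or.inr h2, h41⟩) hb⟩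
      rw [hKW]
      exact (kodairaSymbolAt_and_ordMinimalDiscriminant_mordell_two_of_emod_four_eq_one v hv M e₁ e₂
        e₃ e₄ h41 e₆).1
    · refine ⟨fun hb => absurd (hbit.1 hb).2 (by omega), fun _ => Or.inr (Or.inr (Or.inl ?_))⟩
      rw [hKW]
      exact (kodairaSymbolAt_and_ordMinimalDiscriminant_mordell_two_of_emod_four_eq_three v hv M e₁
        e₂ e₃ e₄ h43 e₆).1
  · rw [h3, show ((2 : ℤ) ^ 3) = 8 by norm_num] at e₆
    refine ⟨fun hb => absurd (hbit.1 hb).1 (by omega), fun _ => Or.inr (Or.inr (Or.inl ?_))⟩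
    rw [hKW]
    exact (kodairaSymbolAt_and_ordMinimalDiscriminant_mordell_three v hv M e₁ e₂ e₃ e₄ hu2 e₆).1
  · rw [h4, show ((2 : ℤ) ^ 4) = 16 by norm_num] at e₆
    rcases hu4 with h41 | h43
    · refine ⟨fun hb => absurd (hbit.1 hb).1 (by omega), fun _ => Or.inl (hGW ?_)⟩
      exact hasGoodReductionAt_mordell_four_of_emod_four_eq_one v hv M e₁ e₂ e₃ e₄ h41 e₆
    · refine ⟨fun hb => absurd (hbit.1 hb).1 (by omega), fun _ => Or.inr (Or.inr (Or.inr ?_))⟩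
      rw [hKW]
      exact (kodairaSymbolAt_and_ordMinimalDiscriminant_mordell_four_of_emod_four_eq_three v hv M e₁
        e₂ e₃ e₄ h43 e₆).1
  · rw [h5, show ((2 : ℤ) ^ 5) = 32 by norm_num] at e₆
    refine ⟨fun hb => absurd (hbit.1 hb).1 (by omega), fun _ => Or.inr (Or.inr (Or.inr ?_))⟩
    rw [hKW]
    exact (kodairaSymbolAt_and_ordMinimalDiscriminant_mordell_five v hv M e₁ e₂ e₃ e₄ hu2 e₆).1

end Two

/-! ### §3 `ord₃ c_w(W_K)` at an unramified place `w ∣ v` from the Kodaira type of `W` at `v` -/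

section KSide

variable {K : Type} [Field K] [NumberField K] (W : WeierstrassCurve ℚ) [W.IsElliptic]
  (v : HeightOneSpectrum (𝓞 ℚ)) {w : HeightOneSpectrum (𝓞 K)}

/-- **Kodaira transport along `e(w | v) = 1`** (tree theorem A233
`UnramifiedBaseChange.kodairaSymbolAt_baseChange_of_ramificationIdx_eq_one_holds`, in the
`e = 1` currency via `AdditivePotMult.not_map_le_sq_of_ramificationIdx_eq_one`).
[cite: SilvermanAEC2009, Prop. VII.5.4 (a) with proof] -/
theorem kodairaSymbolAt_baseChange_eq_of_ramificationIdx_eq_one (hw : w.under (𝓞 ℚ) = v)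
    (he : w.asIdeal.ramificationIdx (𝓞 ℚ) = 1) :
    (W.baseChange K).kodairaSymbolAt w = W.kodairaSymbolAt v := by
  haveI : PerfectField (IsLocalRing.ResidueField (v.adicCompletionIntegers ℚ)) := PerfectField.ofFinite
  haveI : Finite (IsLocalRing.ResidueField (w.adicCompletionIntegers K)) :=
    HeightOneSpectrum.finite_residueField_adicCompletionIntegers K w
  haveI : PerfectField (IsLocalRing.ResidueField (w.adicCompletionIntegers K)) := PerfectField.ofFinite
  have hc : (algebraMap ℚ K).comp (algebraMap (𝓞 ℚ) ℚ) =
      (algebraMap (𝓞 K) K).comp (algebraMap (𝓞 ℚ) (𝓞 K)) := by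
    rw [← IsScalarTower.algebraMap_eq, ← IsScalarTower.algebraMap_eq]
  have hwv : w.asIdeal.under (𝓞 ℚ) = v.asIdeal := by rw [← hw]; rfl
  exact (UnramifiedBaseChange.kodairaSymbolAt_baseChange_of_ramificationIdx_eq_one_holds K v w W hc
    hwv (AdditivePotMult.not_map_le_sq_of_ramificationIdx_eq_one hw he)).1

/-- **`ord₃ c_w(W_K) = 1` at an unramified place of EVEN residue degree above a place `v ∤ 3` of
Kodaira type IV or IV*** (`c_w = 3`: the Step-5 / Step-8 quadratic splits over the even-degree
residue field; tree `TypeIVTwist.localTamagawaNumber_baseChange_eq_three_of_kodairaSymbolAt_eq_IV[star]…`).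
[cite: SilvermanATAEC1994, IV.9.4 Steps 5 and 8 (PDF pp. 344–346)] -/
theorem padicValNat_localTamagawaNumber_baseChange_eq_one_of_IV (hw : w.under (𝓞 ℚ) = v)
    (he : w.asIdeal.ramificationIdx (𝓞 ℚ) = 1) (hf : Even (w.asIdeal.inertiaDeg (𝓞 ℚ)))
    (hv3 : natGenerator v ≠ 3)
    (hIV : W.kodairaSymbolAt v = .IV ∨ W.kodairaSymbolAt v = .IVstar) :
    padicValNat 3 (((W.baseChange K).baseChange (w.adicCompletion K)).localTamagawaNumber
      (w.adicCompletionIntegers K)) = 1 := by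
  have hv3' : (primesEquiv v : ℕ) ≠ 3 := hv3
  rcases hIV with h | h
  · simp [AdditivePotMult.TypeIVTwist.localTamagawaNumber_baseChange_eq_three_of_kodairaSymbolAt_eq_IV_of_unramified_of_even
      v W hv3' h hw he hf]
  · simp [AdditivePotMult.TypeIVTwist.localTamagawaNumber_baseChange_eq_three_of_kodairaSymbolAt_eq_IVstar_of_unramified_of_even
      v W hv3' h hw he hf]

/-- **`ord₃ c_w(W_K) = 0` at an unramified place above a place of Kodaira type II, I₀* or II***
(the type transports, A233; then `c_w = 1`, `c_w ∈ {1, 2, 4}`, `c_w = 1`: Tate's algorithm Steps 3, 6,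
10, tree `NeronComponentIndex*Proofs`). [cite: SilvermanATAEC1994, IV.9.4 Steps 3, 6 and 10 (PDF pp. 344–346)] -/
theorem padicValNat_localTamagawaNumber_baseChange_eq_zero_of_kodairaSymbolAt (hw : w.under (𝓞 ℚ) = v)
    (he : w.asIdeal.ramificationIdx (𝓞 ℚ) = 1)
    (hT : W.kodairaSymbolAt v = .II ∨ W.kodairaSymbolAt v = .Istar 0 ∨ W.kodairaSymbolAt v = .IIstar) :
    padicValNat 3 (((W.baseChange K).baseChange (w.adicCompletion K)).localTamagawaNumber
      (w.adicCompletionIntegers K)) = 0 := by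
  haveI : Finite (IsLocalRing.ResidueField (w.adicCompletionIntegers K)) :=
    HeightOneSpectrum.finite_residueField_adicCompletionIntegers K w
  haveI : PerfectField (IsLocalRing.ResidueField (w.adicCompletionIntegers K)) := PerfectField.ofFinite
  haveI : (W.baseChange K).IsElliptic := by rw [baseChange]; infer_instance
  have hKw := kodairaSymbolAt_baseChange_eq_of_ramificationIdx_eq_one (K := K) W v hw he
  rcases hT with h | h | h
  · simp [localTamagawaNumber_eq_one_of_kodairaSymbolAt_eq_II_holds w (W.baseChange K) (hKw.trans h)]
  · rcases localTamagawaNumber_of_kodairaSymbolAt_eq_Istar_zero_holds w (W.baseChange K) (hKw.trans h)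
      with h1 | h1 | h1 <;> rw [h1]
    · simp
    · exact padicValNat.eq_zero_of_not_dvd (by norm_num)
    · exact padicValNat.eq_zero_of_not_dvd (by norm_num)
  · simp [localTamagawaNumber_eq_one_of_kodairaSymbolAt_eq_IIstar_holds w (W.baseChange K) (hKw.trans h)]

/-- **`ord₃ c_w(W_K) = 0` above a place of good reduction** (good reduction ascends, `c_w = 1`).
[cite: SilvermanAEC2009, VII.2 remark after Prop. 2.1] -/
theorem padicValNat_localTamagawaNumber_baseChange_eq_zero_of_good (hw : w.under (𝓞 ℚ) = v)
    (hgood : W.HasGoodReductionAt v) :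
    padicValNat 3 (((W.baseChange K).baseChange (w.adicCompletion K)).localTamagawaNumber
      (w.adicCompletionIntegers K)) = 0 := by
  haveI : w.asIdeal.LiesOver v.asIdeal := ⟨by rw [← hw]; rfl⟩
  haveI : (W.baseChange K).IsElliptic := by rw [baseChange]; infer_instance
  rw [localTamagawaNumber_eq_one_of_hasGoodReductionAt_holds (W.baseChange K) w
    (hasGoodReductionAt_baseChange_of_hasGoodReductionAt_rat W v w hgood)]
  simp

end KSide
/-! ### §4 Combined: `ord₃ c_w(W_K)` at a place of residue degree `2` above `ℓ ≠ 3`, from `k` -/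

section Combined

variable {K : Type} [Field K] [NumberField K] (W : WeierstrassCurve ℚ) [W.IsElliptic]
  {C : VariableChange ℚ} {k : ℤ} (v : HeightOneSpectrum (𝓞 ℚ)) {w : HeightOneSpectrum (𝓞 K)}

/-- `twoAdicIVBit` takes the values `0, 1`. [folklore] -/
theorem twoAdicIVBit_eq_zero_or_one (k : ℤ) (a : ℕ) : twoAdicIVBit k a = 0 ∨ twoAdicIVBit k a = 1 := by
  unfold twoAdicIVBit; split_ifs <;> simp

/-- **`ord₃ c_w(W_K)` from `k`, at a place `w` of ANY number field `K` with `e(w|ℓ) = 1`, `f(w|ℓ) = 2`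
over a prime `ℓ ≠ 3`, for `W ≅ (y² = x³ + k)`, `64 ∤ k`:** `= twoAdicIVBit k (v₂ k)` when `ℓ = 2`, and
`= [v_ℓ(k) mod 6 ∈ {2, 4}]` when `ℓ ≥ 5` (§1–§3 assembled). [cite: SilvermanATAEC1994, IV.9.4 and Table 4.1] -/
theorem padicValNat_localTamagawaNumber_baseChange_of_mordell (hM : C • W = ⟨0, 0, 0, 0, (k : ℚ)⟩)
    (hk : k ≠ 0) (h64 : ¬ (64 : ℤ) ∣ k) (hw : w.under (𝓞 ℚ) = v)
    (he : w.asIdeal.ramificationIdx (𝓞 ℚ) = 1) (hf : w.asIdeal.inertiaDeg (𝓞 ℚ) = 2)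
    (hv3 : natGenerator v ≠ 3) :
    padicValNat 3 (((W.baseChange K).baseChange (w.adicCompletion K)).localTamagawaNumber
      (w.adicCompletionIntegers K)) =
      if natGenerator v = 2 then twoAdicIVBit k (k.natAbs.factorization 2)
      else if k.natAbs.factorization (natGenerator v) % 6 = 2 ∨
          k.natAbs.factorization (natGenerator v) % 6 = 4 then 1 else 0 := by
  have hfe : Even (w.asIdeal.inertiaDeg (𝓞 ℚ)) := by rw [hf]; exact even_two
  by_cases hv2 : natGenerator v = 2
  · rw [if_pos hv2]
    obtain ⟨hIV, hnot⟩ := kodairaSymbolAt_two_of_mordell W v hM hk h64 hv2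
    rcases twoAdicIVBit_eq_zero_or_one k (k.natAbs.factorization 2) with hb | hb <;> rw [hb]
    · rcases hnot (by rw [hb]; exact zero_ne_one) with hg | hT
      · exact padicValNat_localTamagawaNumber_baseChange_eq_zero_of_good W v hw hg
      · exact padicValNat_localTamagawaNumber_baseChange_eq_zero_of_kodairaSymbolAt W v hw he hT
    · exact padicValNat_localTamagawaNumber_baseChange_eq_one_of_IV W v hw he hfe hv3 (hIV hb)
  · rw [if_neg hv2]
    obtain ⟨hgood, hkod⟩ := hasGoodReductionAt_or_kodairaSymbolAt_of_mordell W v hM hk hv2 hv3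
    by_cases h0 : k.natAbs.factorization (natGenerator v) % 6 = 0
    · rw [if_neg (by omega)]
      exact padicValNat_localTamagawaNumber_baseChange_eq_zero_of_good W v hw (hgood h0)
    · have hK := hkod h0
      by_cases h24 : k.natAbs.factorization (natGenerator v) % 6 = 2 ∨
          k.natAbs.factorization (natGenerator v) % 6 = 4
      · rw [if_pos h24]
        apply padicValNat_localTamagawaNumber_baseChange_eq_one_of_IV W v hw he hfe hv3
        rcases h24 with h2 | h4
        · left; rw [hK]; simp [h2]
        · right; rw [hK]; simp [h4]
      · rw [if_neg h24]
        apply padicValNat_localTamagawaNumber_baseChange_eq_zero_of_kodairaSymbolAt W v hw he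
        rw [hK]
        have h135 : k.natAbs.factorization (natGenerator v) % 6 = 1 ∨
            k.natAbs.factorization (natGenerator v) % 6 = 3 ∨
            k.natAbs.factorization (natGenerator v) % 6 = 5 := by omega
        rcases h135 with h1 | h3 | h5
        · left; simp [h1]
        · right; left; simp [h3]
        · right; right; simp [h5]

end Combined

end Summit.BirchSwinnertonDyer.Rank1Residual.X12.CMRamifiedRecords
end
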